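import Summits.NavierStokesRegularity.NavierStokesRegularity.Theorems.LerayQuarterDissipationFiniteDissipationLiouvillePersistenceSeq
import Summits.NavierStokesRegularity.NavierStokesRegularity.Theorems.IsobarTomographyBlobRiccatiClosureTypeIGaugeBounds
import Literature.Analysis.FluidPDE.DerivativeHolderInterpolation
import Literature.Analysis.FluidPDE.ConstantinFeffermanEnstrophySlab
import HarnessLib

/-!
# Crux `FiniteDissipationLiouville` (stmt-NavierStokesRegularity-22144): along KNSS-convergent
# sequences of the Type-I class the VORTICITY GRADIENTS converge too

Theorems file of route `LerayQuarterDissipation` (lead prover g14; `--supports` the crux; file 3 of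
the THRESHOLD-ONE chain). Navier–Stokes regularity is NOT proved by anything here; no summit is.

KNSS compactness across members of the Type-I ancient mild class (`Compactness.seqLimit`) gives
uniform convergence of the fields on the slab pieces and pointwise convergence of the first spatial
derivatives. The equality case of the threshold budget (`…ThresholdOne`) needs the SECOND spatial
derivatives (the vorticity gradient `DΩ`) of the slice `t = −1` to converge as well. They do, by the
CLASS-UNIFORM gauge bounds `‖Dᵏ W(−1,·)‖ ≤ K_k(C)` (`typeIGauge_exists_pow_mul_norm_iteratedFDeriv_le`,
KNSS 2009 Prop. 4.1 + scaling) and two rounds of Landau's two-function interpolation inequality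
(`DerivInterp.norm_iteratedFDeriv_succ_sub_le`):

* `exists_norm_iteratedFDeriv_slice_le` — `‖Dᵏ W(−1,·)‖ ≤ K_k` uniformly on the class;
* `tendsto_fderiv_slice_unif` — uniform convergence of the slices `−1` on every ball upgrades to
  uniform convergence of their gradients on every ball;
* `tendsto_curl_slice`, `tendsto_fderiv_curl_slice` — hence the vorticities `curl v_j(−1,·)` converge
  uniformly on balls and their gradients `D curl v_j(−1,·)` converge pointwise (second round, applied
  to the vorticities, with the class-uniform bound on `D²curl = curlCLM ∘ D³`).

HONEST FRAMING: plumbing (parabolic smoothing + interpolation); nothing is excluded here.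

References: Koch–Nadirashvili–Seregin–Šverák, arXiv:0709.3599 Prop. 4.1 and Lemma 6.1; E. Landau
(1913) / Kolmogorov interpolation.
-/

noncomputable section

set_option linter.dupNamespace false

namespace Summit.NavierStokesRegularity.NavierStokesRegularity.Theorems.FiniteDissipationLiouville.ThresholdOne

open MeasureTheory Set Filter Topology Metric Function
open Literature.Analysis Literature.Analysis.FluidPDE
open Summit.NavierStokesRegularity.NavierStokesRegularity.Theorems
open Summit.NavierStokesRegularity.NavierStokesRegularity.Theorems.BlobRiccatiClosure.TypeIApexLiouville
open scoped ENNReal NNReal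

/-! ### Class-uniform derivative bounds on the slice `-1` -/

/-- **Class-uniform bounds on the slice `t = −1`**: for every `C` and `k` there is `K ≥ 0` with
`‖Dᵏ W(−1,·)(x)‖ ≤ K` for every Type-I ancient mild field `W` with constant `C` and every `x`
(`typeIGauge_exists_pow_mul_norm_iteratedFDeriv_le` at `t = −1`, where `√1 = 1`). [cite: KochNadirashviliSereginSverak2009, Prop. 4.1 (arXiv:0709.3599 p. 8)] -/
theorem exists_norm_iteratedFDeriv_slice_le (C : ℝ) (k : ℕ) : ∃ K : ℝ, 0 ≤ K ∧
    ∀ ⦃W : ℝ → EuclideanSpace ℝ (Fin 3) → EuclideanSpace ℝ (Fin 3)⦄, IsTypeIAncientMild C W →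
      ∀ x, ‖iteratedFDeriv ℝ k (W (-1)) x‖ ≤ K := by
  obtain ⟨K, hK⟩ := typeIGauge_exists_pow_mul_norm_iteratedFDeriv_le C k
  refine ⟨max K 0, le_max_right _ _, fun W hW x => ?_⟩
  have h := hK hW (-1) (by norm_num) x
  rw [neg_neg, Real.sqrt_one, one_pow, one_mul] at h
  exact h.trans (le_max_left _ _)

/-! ### Gradients converge uniformly on balls -/

variable {C : ℝ} {v : ℕ → ℝ → EuclideanSpace ℝ (Fin 3) → EuclideanSpace ℝ (Fin 3)}
  {W : ℝ → EuclideanSpace ℝ (Fin 3) → EuclideanSpace ℝ (Fin 3)}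

/-- From the slab-piece convergence of `Compactness.seqLimit`: the slices `−1` converge uniformly on
every closed ball `B̄(0, n+2)`, in `ε`-form. -/
theorem eventually_norm_sub_slice_lt
    (hunif : ∀ n : ℕ, TendstoUniformlyOn (fun j z => v j z.1 z.2) (fun z => W z.1 z.2) atTop
      (Icc (-((n : ℝ) + 2)) (-(1 / ((n : ℝ) + 2))) ×ˢ
        closedBall (0 : EuclideanSpace ℝ (Fin 3)) ((n : ℝ) + 2)))
    (n : ℕ) {ε : ℝ} (hε : 0 < ε) :
    ∀ᶠ j in atTop, ∀ y ∈ closedBall (0 : EuclideanSpace ℝ (Fin 3)) ((n : ℝ) + 2),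
      ‖v j (-1) y - W (-1) y‖ < ε := by
  have hmem : ∀ y ∈ closedBall (0 : EuclideanSpace ℝ (Fin 3)) ((n : ℝ) + 2),
      ((-1 : ℝ), y) ∈ Icc (-((n : ℝ) + 2)) (-(1 / ((n : ℝ) + 2))) ×ˢ
        closedBall (0 : EuclideanSpace ℝ (Fin 3)) ((n : ℝ) + 2) := by
    intro y hy
    refine ⟨⟨?_, ?_⟩, hy⟩
    · have : (0 : ℝ) ≤ n := n.cast_nonneg
      linarith
    · have hn2 : (1 : ℝ) ≤ (n : ℝ) + 2 := by
        have : (0 : ℝ) ≤ n := n.cast_nonneg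
        linarith
      have : 1 / ((n : ℝ) + 2) ≤ 1 := (div_le_one (by positivity)).2 hn2
      linarith
  have h := (Metric.tendstoUniformlyOn_iff.1 (hunif n)) ε hε
  filter_upwards [h] with j hj
  intro y hy
  have := hj ((-1 : ℝ), y) (hmem y hy)
  rw [dist_eq_norm] at this
  simpa [norm_sub_rev] using this

/-- **Gradients of the slices converge uniformly on balls.** If `v j`, `W` are Type-I ancient mild
with a common constant `C` and the `v j` converge to `W` uniformly on the slab pieces, then for every
`n` and `ε > 0`, eventually `‖D(v_j(−1,·))(y) − D(W(−1,·))(y)‖ ≤ ε` for all `y ∈ B̄(0, n+1)`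
(Landau's two-function inequality on `B(y,1) ⊆ B̄(0,n+2)` with the class-uniform bound on `D²`). [cite: KochNadirashviliSereginSverak2009, Prop. 4.1 (arXiv:0709.3599 p. 8)] -/
theorem tendsto_fderiv_slice_unif (hv : ∀ j, IsTypeIAncientMild C (v j)) (hW : IsTypeIAncientMild C W)
    (hunif : ∀ n : ℕ, TendstoUniformlyOn (fun j z => v j z.1 z.2) (fun z => W z.1 z.2) atTop
      (Icc (-((n : ℝ) + 2)) (-(1 / ((n : ℝ) + 2))) ×ˢ
        closedBall (0 : EuclideanSpace ℝ (Fin 3)) ((n : ℝ) + 2)))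
    (n : ℕ) {ε : ℝ} (hε : 0 < ε) :
    ∀ᶠ j in atTop, ∀ y ∈ closedBall (0 : EuclideanSpace ℝ (Fin 3)) ((n : ℝ) + 1),
      ‖fderiv ℝ (v j (-1)) y - fderiv ℝ (W (-1)) y‖ ≤ ε := by
  obtain ⟨K₂, hK₂0, hK₂⟩ := exists_norm_iteratedFDeriv_slice_le C 2
  -- choose the interpolation radius `ρ` and then the sup-closeness `A`
  set ρ : ℝ := min (1 / 2) (ε / (4 * K₂ + 1)) with hρ
  have hρpos : 0 < ρ := lt_min (by norm_num) (by positivity)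
  have hρ1 : ρ < 1 := lt_of_le_of_lt (min_le_left _ _) (by norm_num)
  have hρK : 2 * K₂ * ρ ≤ ε / 2 := by
    have h1 : ρ ≤ ε / (4 * K₂ + 1) := min_le_right _ _
    have h2 : 2 * K₂ * ρ ≤ 2 * K₂ * (ε / (4 * K₂ + 1)) := mul_le_mul_of_nonneg_left h1 (by positivity)
    have h3 : 2 * K₂ * (ε / (4 * K₂ + 1)) ≤ ε / 2 := by
      rw [show 2 * K₂ * (ε / (4 * K₂ + 1)) = (2 * K₂ * ε) / (4 * K₂ + 1) by ring,
        div_le_div_iff₀ (by positivity) (by norm_num)]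
      nlinarith
    linarith
  set A : ℝ := ε * ρ / 4 with hA
  have hApos : 0 < A := by positivity
  have hAρ : 2 * A / ρ = ε / 2 := by rw [hA]; field_simp; ring
  filter_upwards [eventually_norm_sub_slice_lt hunif n hApos] with j hj
  intro y hy
  -- `B(y, 1) ⊆ B̄(0, n+2)`
  have hball : ∀ z ∈ ball y 1, z ∈ closedBall (0 : EuclideanSpace ℝ (Fin 3)) ((n : ℝ) + 2) := by
    intro z hz
    rw [mem_closedBall, dist_zero_right] at hy ⊢
    rw [mem_ball, dist_eq_norm] at hz
    have : ‖z‖ ≤ ‖z - y‖ + ‖y‖ := norm_le_norm_sub_add z y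
    linarith
  have hle : ∀ m : ℕ, (m : WithTop ℕ∞) ≤ ((⊤ : ℕ∞) : WithTop ℕ∞) := fun m => by
    exact_mod_cast le_top
  have hsm : ∀ (f : ℝ → EuclideanSpace ℝ (Fin 3) → EuclideanSpace ℝ (Fin 3)), IsTypeIAncientMild C f →
      ∀ z, ContDiffAt ℝ (⊤ : ℕ∞) (f (-1)) z := fun f hf z =>
    (hf.contDiff_slice (by norm_num)).contDiffAt
  have h := DerivInterp.norm_iteratedFDeriv_succ_sub_le (k := 0) (N := (⊤ : ℕ∞)) (x := y) (h := 1)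
    (fun z _ => hsm _ (hv j) z) (fun z _ => hsm _ hW z) (hle _)
    (A := A) (K := K₂) (fun z hz => ?_) hK₂0 (fun z _ => hK₂ (hv j) z) (fun z _ => hK₂ hW z)
    hρpos hρ1
  · -- convert `D¹`-iterated derivatives to `fderiv`
    have h' : ‖iteratedFDeriv ℝ 1 (v j (-1)) y - iteratedFDeriv ℝ 1 (W (-1)) y‖ ≤
        2 * A / ρ + 2 * K₂ * ρ := h
    have e : ‖iteratedFDeriv ℝ 1 (v j (-1)) y - iteratedFDeriv ℝ 1 (W (-1)) y‖ =
        ‖fderiv ℝ (v j (-1)) y - fderiv ℝ (W (-1)) y‖ := by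
      rw [← iteratedFDeriv_sub_apply ((hsm _ (hv j) y).of_le (hle _)) ((hsm _ hW y).of_le (hle _)),
        norm_iteratedFDeriv_one]
      have epi : (v j (-1) - W (-1)) = fun z => v j (-1) z - W (-1) z := rfl
      rw [epi, fderiv_fun_sub ((hsm _ (hv j) y).differentiableAt (by simp))
        ((hsm _ hW y).differentiableAt (by simp))]
    rw [e] at h'
    calc ‖fderiv ℝ (v j (-1)) y - fderiv ℝ (W (-1)) y‖ ≤ 2 * A / ρ + 2 * K₂ * ρ := h'
      _ ≤ ε / 2 + ε / 2 := by rw [hAρ]; exact add_le_add le_rfl hρK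
      _ = ε := by ring
  · -- the `D⁰` closeness on `B(y, 1)`
    rw [← iteratedFDeriv_sub_apply ((hsm _ (hv j) z).of_le (hle _)) ((hsm _ hW z).of_le (hle _)),
      norm_iteratedFDeriv_zero]
    exact (hj z (hball z hz)).le

/-! ### Vorticities and vorticity gradients converge -/

/-- **The vorticities of the slices converge uniformly on balls**:
`‖curl v_j(−1,·)(y) − curl W(−1,·)(y)‖ ≤ ‖curlCLM‖ · ‖D(v_j − W)(y)‖`. -/
theorem tendsto_curl_slice_unif (hv : ∀ j, IsTypeIAncientMild C (v j)) (hW : IsTypeIAncientMild C W)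
    (hunif : ∀ n : ℕ, TendstoUniformlyOn (fun j z => v j z.1 z.2) (fun z => W z.1 z.2) atTop
      (Icc (-((n : ℝ) + 2)) (-(1 / ((n : ℝ) + 2))) ×ˢ
        closedBall (0 : EuclideanSpace ℝ (Fin 3)) ((n : ℝ) + 2)))
    (n : ℕ) {ε : ℝ} (hε : 0 < ε) :
    ∀ᶠ j in atTop, ∀ y ∈ closedBall (0 : EuclideanSpace ℝ (Fin 3)) ((n : ℝ) + 1),
      ‖curl (v j (-1)) y - curl (W (-1)) y‖ ≤ ε := by
  set κ : ℝ := ‖curlCLM‖ with hκdef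
  have hκ0 : 0 ≤ κ := by rw [hκdef]; exact norm_nonneg curlCLM
  have hκ : 0 < κ + 1 := by linarith
  filter_upwards [tendsto_fderiv_slice_unif hv hW hunif n (ε := ε / (κ + 1))
    (by positivity)] with j hj
  intro y hy
  rw [curl_eq_curlCLM, curl_eq_curlCLM, ← map_sub]
  calc ‖curlCLM (fderiv ℝ (v j (-1)) y - fderiv ℝ (W (-1)) y)‖
      ≤ κ * ‖fderiv ℝ (v j (-1)) y - fderiv ℝ (W (-1)) y‖ :=
        ContinuousLinearMap.le_opNorm _ _
    _ ≤ (κ + 1) * (ε / (κ + 1)) :=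
        mul_le_mul (by linarith) (hj y hy) (norm_nonneg _) hκ.le
    _ = ε := by field_simp

/-- **THE VORTICITY GRADIENTS OF THE SLICES CONVERGE POINTWISE.** For Type-I ancient mild `v j`,
`W` with a common constant, converging uniformly on the slab pieces: for every `y`,
`D(curl v_j(−1,·))(y) → D(curl W(−1,·))(y)` (second round of Landau's inequality, applied to the
vorticities on `B(y,1)`, with the class-uniform bound `‖D²curl‖ ≤ ‖curlCLM‖ K₃`). [cite: KochNadirashviliSereginSverak2009, Prop. 4.1 (arXiv:0709.3599 p. 8)] -/
theorem tendsto_fderiv_curl_slice (hv : ∀ j, IsTypeIAncientMild C (v j)) (hW : IsTypeIAncientMild C W)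
    (hunif : ∀ n : ℕ, TendstoUniformlyOn (fun j z => v j z.1 z.2) (fun z => W z.1 z.2) atTop
      (Icc (-((n : ℝ) + 2)) (-(1 / ((n : ℝ) + 2))) ×ˢ
        closedBall (0 : EuclideanSpace ℝ (Fin 3)) ((n : ℝ) + 2)))
    (y : EuclideanSpace ℝ (Fin 3)) :
    Tendsto (fun j => fderiv ℝ (curl (v j (-1))) y) atTop (𝓝 (fderiv ℝ (curl (W (-1))) y)) := by
  obtain ⟨K₃, hK₃0, hK₃⟩ := exists_norm_iteratedFDeriv_slice_le C 3
  set κ : ℝ := ‖curlCLM‖ with hκdef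
  have hκ0 : 0 ≤ κ := by rw [hκdef]; exact norm_nonneg curlCLM
  have hle : ∀ m : ℕ, (m : WithTop ℕ∞) ≤ ((⊤ : ℕ∞) : WithTop ℕ∞) := fun m => by
    exact_mod_cast le_top
  -- a ball `B̄(0, n+1)` containing `B(y, 1)`
  obtain ⟨n, hn⟩ := exists_nat_ge ‖y‖
  have hball : ∀ z ∈ ball y 1, z ∈ closedBall (0 : EuclideanSpace ℝ (Fin 3)) ((n : ℝ) + 1) := by
    intro z hz
    rw [mem_closedBall, dist_zero_right]
    rw [mem_ball, dist_eq_norm] at hz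
    have : ‖z‖ ≤ ‖z - y‖ + ‖y‖ := norm_le_norm_sub_add z y
    linarith
  -- smoothness of the vorticity slices and the class-uniform bound on `D² curl`
  have hsm : ∀ (f : ℝ → EuclideanSpace ℝ (Fin 3) → EuclideanSpace ℝ (Fin 3)), IsTypeIAncientMild C f →
      ContDiff ℝ (⊤ : ℕ∞) (f (-1)) := fun f hf => hf.contDiff_slice (by norm_num)
  have hcsm : ∀ (f : ℝ → EuclideanSpace ℝ (Fin 3) → EuclideanSpace ℝ (Fin 3)), IsTypeIAncientMild C f →
      ∀ z, ContDiffAt ℝ (⊤ : ℕ∞) (curl (f (-1))) z := fun f hf z =>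
    (contDiff_curl ((hsm f hf).of_le (by exact_mod_cast le_top)) (n := (⊤ : ℕ∞))).contDiffAt
  have hK2curl : ∀ (f : ℝ → EuclideanSpace ℝ (Fin 3) → EuclideanSpace ℝ (Fin 3)), IsTypeIAncientMild C f →
      ∀ z, ‖iteratedFDeriv ℝ (0 + 2) (curl (f (-1))) z‖ ≤ κ * K₃ := by
    intro f hf z
    have h := norm_iteratedFDeriv_curl_le_opNorm_mul (hsm f hf) 2 le_top z
    exact h.trans (mul_le_mul_of_nonneg_left (hK₃ hf z) hκ0)
  -- `ε`-argument
  rw [Metric.tendsto_atTop]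
  intro ε hε
  set ρ : ℝ := min (1 / 2) (ε / (8 * (κ * K₃) + 1)) with hρ
  have hρpos : 0 < ρ := lt_min (by norm_num) (by positivity)
  have hρ1 : ρ < 1 := lt_of_le_of_lt (min_le_left _ _) (by norm_num)
  have hρK : 2 * (κ * K₃) * ρ ≤ ε / 4 := by
    have h1 : ρ ≤ ε / (8 * (κ * K₃) + 1) := min_le_right _ _
    have h2 : 2 * (κ * K₃) * ρ ≤ 2 * (κ * K₃) * (ε / (8 * (κ * K₃) + 1)) :=
      mul_le_mul_of_nonneg_left h1 (by positivity)
    have h3 : 2 * (κ * K₃) * (ε / (8 * (κ * K₃) + 1)) ≤ ε / 4 := by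
      rw [show 2 * (κ * K₃) * (ε / (8 * (κ * K₃) + 1)) = (2 * (κ * K₃) * ε) / (8 * (κ * K₃) + 1) by ring,
        div_le_div_iff₀ (by positivity) (by norm_num)]
      nlinarith [mul_nonneg hκ0 hK₃0]
    linarith
  set A : ℝ := ε * ρ / 8 with hA
  have hApos : 0 < A := by positivity
  have hAρ : 2 * A / ρ = ε / 4 := by rw [hA]; field_simp; ring
  obtain ⟨J, hJ⟩ := (tendsto_curl_slice_unif hv hW hunif n hApos).exists_forall_of_atTop
  refine ⟨J, fun j hj => ?_⟩
  rw [dist_eq_norm]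
  have h := DerivInterp.norm_iteratedFDeriv_succ_sub_le (k := 0) (N := (⊤ : ℕ∞)) (x := y) (h := 1)
    (fun z _ => hcsm _ (hv j) z) (fun z _ => hcsm _ hW z) (hle _)
    (A := A) (K := κ * K₃) (fun z hz => ?_) (mul_nonneg hκ0 hK₃0)
    (fun z _ => hK2curl _ (hv j) z) (fun z _ => hK2curl _ hW z) hρpos hρ1
  · have h' : ‖iteratedFDeriv ℝ 1 (curl (v j (-1))) y - iteratedFDeriv ℝ 1 (curl (W (-1))) y‖ ≤
        2 * A / ρ + 2 * (κ * K₃) * ρ := h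
    have e : ‖iteratedFDeriv ℝ 1 (curl (v j (-1))) y - iteratedFDeriv ℝ 1 (curl (W (-1))) y‖ =
        ‖fderiv ℝ (curl (v j (-1))) y - fderiv ℝ (curl (W (-1))) y‖ := by
      rw [← iteratedFDeriv_sub_apply ((hcsm _ (hv j) y).of_le (hle _)) ((hcsm _ hW y).of_le (hle _)),
        norm_iteratedFDeriv_one]
      have epi : (curl (v j (-1)) - curl (W (-1))) = fun z => curl (v j (-1)) z - curl (W (-1)) z := rfl
      rw [epi, fderiv_fun_sub ((hcsm _ (hv j) y).differentiableAt (by simp))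
        ((hcsm _ hW y).differentiableAt (by simp))]
    rw [e] at h'
    calc ‖fderiv ℝ (curl (v j (-1))) y - fderiv ℝ (curl (W (-1))) y‖
        ≤ 2 * A / ρ + 2 * (κ * K₃) * ρ := h'
      _ ≤ ε / 4 + ε / 4 := by rw [hAρ]; exact add_le_add le_rfl hρK
      _ < ε := by linarith
  · rw [← iteratedFDeriv_sub_apply ((hcsm _ (hv j) z).of_le (hle _)) ((hcsm _ hW z).of_le (hle _)),
      norm_iteratedFDeriv_zero]
    exact hJ j hj z (hball z hz)

end Summit.NavierStokesRegularity.NavierStokesRegularity.Theorems.FiniteDissipationLiouville.ThresholdOne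

end
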